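import Literature.AlgebraicGeometry.Motives.HodgeThetaAnnihilatorSemisimpleTimesAbelian
import HarnessLib

/-!
# Rational tensors on `V₁ ⊕ V₂` killed by `Θ` are killed by `𝔰𝔭_{E}(V₁, ψ₁)_ℂ ⊕ 0` when `V₁` has real `𝔰𝔩₂`-blocks and EVERY admissible algebra of `V₂` is `𝔰𝔭(V₂, ψ₂)` (Hazama 1989 / Moonen–Zarhin 1999 Thm. (3.2)(1): `Hg(X₁ × X₂) = Hg(X₁) × Hg(X₂)` — the Lie step, Goursat by an ideal of `𝔰𝔭`)

Family `hodge`, layer `Literature/AlgebraicGeometry/Motives` (abstract polarizable `ℚ`-Hodge structures;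
no geometry). Research context: cell `pub-hodge-ring2` (HONEST FRAMING: research route conditional on
HC_CM; not a corollary; Q11.4-sentence-2 already refuted in dim ≥ 3), Literature lane, programme R14 («generic ×
generic products», e.g. `E × S` for an elliptic curve `E` without CM and an abelian surface `S` with
`End⁰(S) = ℚ`). This file is UNCONDITIONAL and no step towards a summit statement. It is the COMPANION of
`HodgeThetaAnnihilatorSemisimpleTimesAbelian` (programme R4, «RM × CM»: the second factor has ABELIAN commutant)
with the second factor now RIGID SYMPLECTIC: every bracket-closed rational `ψ₂`-skew `𝔤₂ ⊆ End_ℚ(V₂)` whose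
complex span contains the Hodge operator `Θ₂` has `(𝔤₂)_ℂ = 𝔰𝔭(V₂ ⊗ ℂ, ψ₂)` — the tree's theorems
`SymplecticTheta.mem_spanC_of_skew` (`dim V₂ = 4`, `End_Hdg = ℚ`; Moonen–Zarhin (2.2) Type I(1)) and
`SymplecticThetaSix.mem_spanC_of_skew` (`dim V₂ = 6`; (2.3) Type I(1)).

THE PRINTED RESULT. Moonen–Zarhin, Math. Ann. 315 (1999), Thm. (3.2)(1) (= Hazama, Duke Math. J. 58 (1989);
Gordon's survey Thm. 7.6.2): «Let `X₁` and `X₂` be complex abelian varieties which both satisfy condition (D).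
(1) Suppose `X₁` and `X₂` contain no factors of Type 4. Then `X₁ × X₂` again satisfies (D), and either
`Hom(X₁, X₂) ≠ 0` or `Hg(X₁ × X₂) = Hg(X₁) × Hg(X₂)`», proved there from (3.1):
«`hg(X₁ × X₂) ≅ 𝔤₁ ⊕ 𝔤₂ ⊕ Γ_φ … where `Γ_φ ⊆ 𝔤₃ ⊕ 𝔤₃` is the graph of the automorphism `φ`» — a Goursat
decomposition along IDEALS of the two Hodge Lie algebras [corpus: paper:arxiv-math_9901113 p. 6].

THIS FILE: THE LIE STEP OF THAT PROOF FOR `hg(X₂) = 𝔰𝔭(V₂)` SIMPLE AND LARGER THAN `hg(X₁)`, WITHOUT ALGEBRAIC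
GROUPS, in the tree's word model (`HodgeThetaAnnihilatorLieAlgebra`, THEOREM L). SETTING as in the companion:
a `ℚ`-space `U` presented as `V₁ ⊕ V₂` (`ι₁, π₁, ι₂, π₂`); Hodge structures `H_U`, `H₁`, `H₂` of the same odd
weight with `ι₁`, `ι₂` mapping Hodge pieces into Hodge pieces; on `V₁` the data of the `Θ`-subalgebra theorem
(`HodgeThetaSubalgebraRealPlacesSl2`: polarization `ψ₁` with `End_Hdg(V₁)` self-adjoint, real characters `σ` of
`End_Hdg(V₁)` with an internal decomposition of `V₁ ⊗ ℂ` into two-dimensional eigenblocks); on `V₂` a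
polarization `ψ₂`, a Hodge operator `Θ₂` and THREE HYPOTHESES, all theorems of the tree in the applications:
(RIGID) every bracket-closed rational `ψ₂`-skew `𝔤₂` with `Θ₂ ∈ (𝔤₂)_ℂ` contains (after `⊗ ℂ`) every
`ψ₂`-skew operator; (IDEAL) every non-zero `ℂ`-subspace of `ψ₂`-skew operators of `V₂ ⊗ ℂ` stable under
bracketing with all `ψ₂`-skew operators contains `Θ₂` (`HodgeThetaSymplecticIdeal`, «`𝔰𝔭` is simple»);
(SIZE) every rational space of `ψ₁`-skew operators of `V₁` commuting with `End_Hdg(V₁)` has dimension `< r`,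
while `V₂ ⊗ ℂ` carries `r` linearly independent `ψ₂`-skew operators (`dim hg(X₁) < dim 𝔰𝔭(V₂)`, which is what
excludes the graph `Γ_φ`: for `X₁ = E` an elliptic curve, `dim 𝔰𝔩₂ = 3 < 10 = dim 𝔰𝔭₄`).
MAIN RESULT (`wordDerAt_assemble_eq_zero_of_realBlocks_times_symplectic`): a RATIONAL coefficient tensor `q` on
`U` killed slice by slice by the matrix of `Θ_U` is killed by the matrix of `ι₁ ∘ Z ∘ π₁` for EVERY block-diagonal
`Z` of `V₁ ⊗ ℂ` with trace-free blocks — the SAME conclusion as the companion's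
`wordDerAt_assemble_eq_zero_of_semisimple_times_abelian`, so that the evaluation pipeline of programme R4
(`RealSl2BlocksTimesCM{Invariance, HodgeClasses, ProductSpan}`) can be run verbatim with the CM factor replaced by
a generic surface or threefold — and by `ι₂ ∘ Y ∘ π₂` for EVERY `ψ₂`-skew `Y`
(`wordDerAt_incl₂_eq_zero_of_realBlocks_times_symplectic`).

PROOF (Deligne LNM 900 I §3 + Hazama's Goursat argument in Lie form). Let `𝔞 ⊆ End_ℚ(U)` be the rational
annihilator algebra of `q` cut out by: killing `q`, commuting with `ι₁π₁`, `ι₂π₂`, `ι₁ a π₁` (`a ∈ End_Hdg(V₁)`),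
and skewness for the ORTHOGONAL SUM `φ_U = ψ₁(π₁ ·, π₁ ·) + ψ₂(π₂ ·, π₂ ·)`. It is bracket-closed and
`Θ_U ∈ 𝔞_ℂ` by descent (§3). Every `X ∈ 𝔞` is block diagonal with corners `c₁X ∈ 𝔰𝔭_E(V₁, ψ₁)`,
`c₂X ∈ 𝔰𝔭(V₂, ψ₂)`, and `c_i[X, X'] = [c_iX, c_iX']` (§1). The corner algebra `c₂(𝔞)` is admissible for `V₂`
(`Θ₂ = c₂ Θ_U`), so by (RIGID) `c₂(𝔞)_ℂ = 𝔰𝔭(V₂ ⊗ ℂ)`. THE GOURSAT STEP (§2): the kernel `K = 𝔞 ∩ ker c₁` is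
non-zero — otherwise `dim 𝔞 = dim c₁(𝔞) < r ≤ dim_ℂ c₂(𝔞)_ℂ ≤ dim c₂(𝔞) ≤ dim 𝔞` by (SIZE) — and `c₂(K)` is an
ideal of `c₂(𝔞)`; its complex span is a non-zero `𝔰𝔭`-stable space of skew operators, so `Θ₂ ∈ c₂(K)_ℂ` by
(IDEAL), and `c₂(K)` is admissible, hence `c₂(K)_ℂ = 𝔰𝔭(V₂ ⊗ ℂ)` by (RIGID) again. By descent every `c₂X'`
(`X' ∈ 𝔞`) is `c₂X''` for some `X'' = ι₂ c₂X'' π₂ ∈ K`, so `ι₂ c₂X' π₂ ∈ 𝔞` and `ι₁ c₁X' π₁ = X' − ι₂ c₂X' π₂ ∈ 𝔞`: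
`𝔞 = ι₁ c₁(𝔞) π₁ ⊕ ι₂ 𝔰𝔭(V₂) π₂`. Finally (§3) `c₁(𝔞)` is admissible for `V₁`, so `c₁(𝔞)_ℂ ⊇ ⊕_i 𝔰𝔩(T_{σ_i})`
by the `Θ`-subalgebra theorem (`ThetaSubalgebra.mem_spanC_iff_mapsTo_and_skew`), and `ι₁ Z π₁ ∈ 𝔞_ℂ` kills `q`.

CONTENTS (all proved; no definition, no named fact, D-0026):
* §1 corner calculus: `corner_bracket` (`c[X,X'] = [cX, cX']` for block-diagonal operators),
  `eq_incl_corner_add` (`X = ι₁ c₁X π₁ + ι₂ c₂X π₂`), `bracket_mem_spanC_of_forall` (ideals complexify), and the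
  private helpers `baseChange_add_apply` (complexification of a sum of forms), `finrank_spanC_le`
  (`dim_ℂ 𝔤_ℂ ≤ dim_ℚ 𝔤`);
* §2 the Goursat step `goursat_incl_corner_mem` for an abstract bracket-closed block-diagonal `𝔞 ⊆ End_ℚ(U)`
  with `ψ₂`-skew second corners whose complex span contains `Θ₂`, under (RIGID), (IDEAL), (SIZE);
* §3 MAIN THEOREMS `wordDerAt_assemble_eq_zero_of_realBlocks_times_symplectic`,
  `wordDerAt_incl₂_eq_zero_of_realBlocks_times_symplectic` (through the common core
  `incl_corner_mem_annLie_of_realBlocks_times_symplectic`: `ι₁ c₁(𝔞) π₁ ⊆ 𝔞`, `ι₂ 𝔰𝔭(V₂) π₂ ⊆ 𝔞`, `Θ_U ∈ 𝔞_ℂ`).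

## References

* [MoonenZarhin1999LowDim] B. Moonen, Yu. Zarhin, Math. Ann. 315 (1999), §3 (3.1) and Thm. (3.2)(1)
  (held: `paper:arxiv-math_9901113` p. 6). [cite: MoonenZarhin1999LowDim, §3 (3.1) and Thm. (3.2)(1)]
* [Hazama1989] F. Hazama, *Algebraic cycles on nonsimple abelian varieties*, Duke Math. J. 58 (1989) 31–37.
  [cite: Hazama1989, Thm. (= Gordon 7.6.2)]
* [Gordon1999HodgeAVSurvey] B. B. Gordon, *A survey of the Hodge conjecture for abelian varieties*, Thm. 7.6.2
  [corpus: paper:arxiv-alg-geom_9709030 p. 21]. [cite: Gordon1999HodgeAVSurvey, Thm. 7.6.2]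
* [Lombardo2016] D. Lombardo, Ann. Inst. Fourier 66 (2016), Lemma 3.2 and Lemma 3.4 (p. 1229) (the companion's
  commutant argument). [cite: Lombardo2016, Lemma 3.4 (p. 1229)]
* [Deligne1982HodgeCycles] P. Deligne, LNM 900 (1982), I §3 (proof of Prop. 3.4). [cite: Deligne1982HodgeCycles, I §3 Prop. 3.4]
* [Hazama1983] F. Hazama, Tôhoku Math. J. 35 (1983), §3 pp. 305–306. [cite: Hazama1983, §3 (pp. 305–306)]
* [GoodmanWallachGTM255] R. Goodman, N. R. Wallach, GTM 255 (2009), §2.1.2, §4.1.1. [cite: GoodmanWallachGTM255, §4.1.1]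
-/

noncomputable section

open scoped TensorProduct
open CategoryTheory Module

namespace Literature.AlgebraicGeometry.Motives

namespace HodgeStructure

open RealPlaces Literature.RepresentationTheory.GeneralLinear

/-! ### §1 Corner calculus of a presentation `U = ι₁ V₁ ⊕ ι₂ V₂`; complex spans -/

section Corners

universe u

variable {U V₁ V₂ : Type u} [AddCommGroup U] [Module ℚ U] [AddCommGroup V₁] [Module ℚ V₁]
  [AddCommGroup V₂] [Module ℚ V₂]

/-- **Corners of brackets.** For block-diagonal `Z`, `Z'` (commuting with the projectors `ι₁π₁`, `ι₂π₂`):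
`π₁ [Z, Z'] ι₁ = [π₁ Z ι₁, π₁ Z' ι₁]` — the corner map `c₁` is a Lie homomorphism on block-diagonal operators
(«`hg(X₁ × X₂) ⊆ hg(X₁) ⊕ hg(X₂)` and the two projections»). [cite: MoonenZarhin1999LowDim, §3 (3.1)] -/
theorem corner_bracket {ι₁ : V₁ →ₗ[ℚ] U} {π₁ : U →ₗ[ℚ] V₁} {ι₂ : V₂ →ₗ[ℚ] U} {π₂ : U →ₗ[ℚ] V₂}
    (hπι₁ : π₁ ∘ₗ ι₁ = LinearMap.id) (hπι₂ : π₂ ∘ₗ ι₂ = LinearMap.id) (hπ₁ι₂ : π₁ ∘ₗ ι₂ = 0)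
    (hsum : ι₁ ∘ₗ π₁ + ι₂ ∘ₗ π₂ = LinearMap.id) {Z Z' : Module.End ℚ U}
    (hZ₁ : Z * (ι₁ ∘ₗ π₁) = (ι₁ ∘ₗ π₁) * Z) (hZ₂ : Z * (ι₂ ∘ₗ π₂) = (ι₂ ∘ₗ π₂) * Z)
    (hZ'₁ : Z' * (ι₁ ∘ₗ π₁) = (ι₁ ∘ₗ π₁) * Z') (hZ'₂ : Z' * (ι₂ ∘ₗ π₂) = (ι₂ ∘ₗ π₂) * Z') :
    π₁ ∘ₗ (Z * Z' - Z' * Z) ∘ₗ ι₁ =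
      (π₁ ∘ₗ Z ∘ₗ ι₁) * (π₁ ∘ₗ Z' ∘ₗ ι₁) - (π₁ ∘ₗ Z' ∘ₗ ι₁) * (π₁ ∘ₗ Z ∘ₗ ι₁) := by
  have e11 : ∀ v, π₁ (ι₁ v) = v := fun v => by
    rw [← LinearMap.comp_apply (f := π₁), hπι₁, LinearMap.id_apply]
  have e12 : ∀ w, π₁ (ι₂ w) = 0 := fun w => by
    rw [← LinearMap.comp_apply (f := π₁), hπ₁ι₂, LinearMap.zero_apply]
  apply LinearMap.ext
  intro v
  rw [LinearMap.comp_apply, LinearMap.comp_apply, LinearMap.sub_apply, Module.End.mul_apply,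
    Module.End.mul_apply, mul_apply_eq_of_commute_projectors hπι₁ hπι₂ hsum hZ₁ hZ₂ hZ'₁ hZ'₂,
    mul_apply_eq_of_commute_projectors hπι₁ hπι₂ hsum hZ'₁ hZ'₂ hZ₁ hZ₂]
  simp only [map_add, map_sub, e11, e12, add_zero, LinearMap.sub_apply, Module.End.mul_apply, LinearMap.comp_apply]

/-- **Block decomposition**: a block-diagonal `X` is `ι₁ c₁X π₁ + ι₂ c₂X π₂`.
[cite: MoonenZarhin1999LowDim, §3 (3.1)] [cite: Lombardo2016, Lemma 3.4 (p. 1229)] -/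
theorem eq_incl_corner_add {ι₁ : V₁ →ₗ[ℚ] U} {π₁ : U →ₗ[ℚ] V₁} {ι₂ : V₂ →ₗ[ℚ] U} {π₂ : U →ₗ[ℚ] V₂}
    (hπι₁ : π₁ ∘ₗ ι₁ = LinearMap.id) (hπι₂ : π₂ ∘ₗ ι₂ = LinearMap.id)
    (hsum : ι₁ ∘ₗ π₁ + ι₂ ∘ₗ π₂ = LinearMap.id) {X : Module.End ℚ U}
    (hX₁ : X * (ι₁ ∘ₗ π₁) = (ι₁ ∘ₗ π₁) * X) (hX₂ : X * (ι₂ ∘ₗ π₂) = (ι₂ ∘ₗ π₂) * X) :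
    X = ι₁ ∘ₗ (π₁ ∘ₗ X ∘ₗ ι₁) ∘ₗ π₁ + ι₂ ∘ₗ (π₂ ∘ₗ X ∘ₗ ι₂) ∘ₗ π₂ := by
  apply LinearMap.ext
  intro y
  conv_lhs => rw [← incl_proj_add_apply hsum y]
  rw [map_add, apply_incl_eq_of_commute_projector hπι₁ hX₁, apply_incl_eq_of_commute_projector hπι₂ hX₂]
  simp only [LinearMap.add_apply, LinearMap.comp_apply]

/-- Complexification of a sum of bilinear forms, evaluated. [folklore] -/
private theorem baseChange_add_apply (B B' : LinearMap.BilinForm ℚ U) (x y : ℂ ⊗[ℚ] U) :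
    LinearMap.BilinForm.baseChange ℂ (B + B') x y =
      LinearMap.BilinForm.baseChange ℂ B x y + LinearMap.BilinForm.baseChange ℂ B' x y := by
  induction x using TensorProduct.induction_on with
  | zero => simp
  | tmul c v =>
    induction y using TensorProduct.induction_on with
    | zero => simp
    | tmul d w =>
      simp only [LinearMap.BilinForm.baseChange_tmul, LinearMap.add_apply, add_smul]
    | add y y' hy hy' => rw [map_add, map_add, map_add, hy, hy']; abel
  | add x x' hx hx' =>
    rw [map_add, LinearMap.add_apply, map_add, map_add, LinearMap.add_apply, LinearMap.add_apply, hx, hx']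
    abel

/-- **`dim_ℂ 𝔤_ℂ ≤ dim_ℚ 𝔤`**: the complex span of a rational space of operators is spanned by the
complexifications of a `ℚ`-basis. [folklore] -/
private theorem finrank_spanC_le [Module.Finite ℚ V₂] (𝔤 : Submodule ℚ (Module.End ℚ V₂)) :
    Module.finrank ℂ (spanC 𝔤) ≤ Module.finrank ℚ 𝔤 := by
  classical
  set bg := Module.finBasis ℚ 𝔤 with hbg
  have hle : spanC 𝔤 ≤ Submodule.span ℂ (Set.range fun i => ((bg i : 𝔤) : Module.End ℚ V₂).baseChange ℂ) := by
    rw [spanC, Submodule.span_le]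
    rintro _ ⟨X, hX, rfl⟩
    have hXsum : X = ∑ i, bg.repr ⟨X, hX⟩ i • ((bg i : 𝔤) : Module.End ℚ V₂) := by
      have h := congrArg Subtype.val (bg.sum_repr ⟨X, hX⟩)
      simp only [Submodule.coe_sum, Submodule.coe_smul] at h
      exact h.symm
    have hbc : (∑ i, bg.repr ⟨X, hX⟩ i • ((bg i : 𝔤) : Module.End ℚ V₂)).baseChange ℂ =
        ∑ i, (bg.repr ⟨X, hX⟩ i • ((bg i : 𝔤) : Module.End ℚ V₂)).baseChange ℂ := by
      have h := map_sum (LinearMap.baseChangeHom ℚ ℂ V₂ V₂)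
        (fun i => bg.repr ⟨X, hX⟩ i • ((bg i : 𝔤) : Module.End ℚ V₂)) Finset.univ
      simpa only [LinearMap.baseChangeHom_apply] using h
    rw [SetLike.mem_coe]
    change X.baseChange ℂ ∈ _
    rw [hXsum, hbc]
    refine Submodule.sum_mem _ fun i _ => ?_
    rw [LinearMap.baseChange_smul, ← algebraMap_smul ℂ (bg.repr ⟨X, hX⟩ i)]
    exact Submodule.smul_mem _ _ (Submodule.subset_span ⟨i, rfl⟩)
  calc Module.finrank ℂ (spanC 𝔤)
      ≤ Module.finrank ℂ (Submodule.span ℂ (Set.range fun i => ((bg i : 𝔤) : Module.End ℚ V₂).baseChange ℂ)) :=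
        Submodule.finrank_mono hle
    _ ≤ Fintype.card (Fin (Module.finrank ℚ 𝔤)) := finrank_range_le_card _
    _ = Module.finrank ℚ 𝔤 := Fintype.card_fin _

/-- **Ideals complexify**: if `[X, Y] ∈ 𝔨` for all `X ∈ 𝔤`, `Y ∈ 𝔨` (rational), then `[Z, W] ∈ 𝔨_ℂ` for all
`Z ∈ 𝔤_ℂ`, `W ∈ 𝔨_ℂ` (bilinearity). [cite: Deligne1982HodgeCycles, I §3 (proof of Prop. 3.4)] -/
theorem bracket_mem_spanC_of_forall {𝔤 𝔨 : Submodule ℚ (Module.End ℚ V₂)}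
    (h : ∀ X ∈ 𝔤, ∀ Y ∈ 𝔨, X * Y - Y * X ∈ 𝔨) {Z W : Module.End ℂ (ℂ ⊗[ℚ] V₂)} (hZ : Z ∈ spanC 𝔤)
    (hW : W ∈ spanC 𝔨) : Z * W - W * Z ∈ spanC 𝔨 := by
  have inner : ∀ X ∈ 𝔤, ∀ W ∈ spanC 𝔨, X.baseChange ℂ * W - W * X.baseChange ℂ ∈ spanC 𝔨 := by
    intro X hX W hW
    induction hW using Submodule.span_induction with
    | mem W' hW' =>
      obtain ⟨Y, hY, rfl⟩ := hW'
      have hm := baseChange_mem_spanC (h X hX Y hY)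
      rw [LinearMap.baseChange_sub, LinearMap.baseChange_mul, LinearMap.baseChange_mul] at hm
      exact hm
    | zero => rw [mul_zero, zero_mul, sub_zero]; exact Submodule.zero_mem _
    | add W' W'' _ _ h' h'' =>
      have e : X.baseChange ℂ * (W' + W'') - (W' + W'') * X.baseChange ℂ =
          (X.baseChange ℂ * W' - W' * X.baseChange ℂ) + (X.baseChange ℂ * W'' - W'' * X.baseChange ℂ) := by
        noncomm_ring
      rw [e]; exact Submodule.add_mem _ h' h''
    | smul c W' _ h' =>
      have e : X.baseChange ℂ * (c • W') - (c • W') * X.baseChange ℂ =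
          c • (X.baseChange ℂ * W' - W' * X.baseChange ℂ) := by
        rw [mul_smul_comm, smul_mul_assoc, smul_sub]
      rw [e]; exact Submodule.smul_mem _ c h'
  induction hZ using Submodule.span_induction with
  | mem Z' hZ' =>
    obtain ⟨X, hX, rfl⟩ := hZ'
    exact inner X hX W hW
  | zero => rw [mul_zero, zero_mul, sub_zero]; exact Submodule.zero_mem _
  | add Z' Z'' _ _ h' h'' =>
    have e : (Z' + Z'') * W - W * (Z' + Z'') = (Z' * W - W * Z') + (Z'' * W - W * Z'') := by noncomm_ring
    rw [e]; exact Submodule.add_mem _ h' h''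
  | smul c Z' _ h' =>
    have e : (c • Z') * W - W * (c • Z') = c • (Z' * W - W * Z') := by
      rw [mul_smul_comm, smul_mul_assoc, smul_sub]
    rw [e]; exact Submodule.smul_mem _ c h'

end Corners

/-! ### §2 The Goursat step: `𝔞 ⊇ ι₁ c₁(𝔞) π₁` and `𝔞 ⊇ ι₂ 𝔰𝔭(V₂, ψ₂) π₂` -/

section Goursat

universe u

variable {U V₁ V₂ : Type u} [AddCommGroup U] [Module ℚ U] [AddCommGroup V₁] [Module ℚ V₁]
  [AddCommGroup V₂] [Module ℚ V₂] [Module.Finite ℚ U] [Module.Finite ℚ V₂] {n : ℤ}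

/-- **The Goursat step (Hazama; Moonen–Zarhin (3.1) with `𝔤₃ = 0`).** Let `U = ι₁V₁ ⊕ ι₂V₂` and let
`𝔞 ⊆ End_ℚ(U)` be a bracket-closed space of block-diagonal operators whose second corners `c₂X = π₂ X ι₂` are
`ψ₂`-skew, such that the Hodge operator `Θ₂` of `V₂` lies in the complex span of `c₂(𝔞)`. Assume (RIGID),
(IDEAL) for `(V₂, ψ₂, Θ₂)` and (SIZE): every space of first corners of `𝔞` has dimension `< r` while `V₂ ⊗ ℂ`
carries `r` independent `ψ₂`-skew operators. Then `ι₁ c₁X π₁ ∈ 𝔞` for every `X ∈ 𝔞`, and `ι₂ Z π₂ ∈ 𝔞` for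
every rational `ψ₂`-skew `Z` — «`Hg(X₁ × X₂) = Hg(X₁) × Hg(X₂)`», the second factor being all of `Sp(V₂, ψ₂)`.
Proof: module docstring (the kernel `K = 𝔞 ∩ ker c₁` is non-zero by dimension count; `c₂(K)` is an ideal of
`c₂(𝔞)`, whose complex span is all of `𝔰𝔭(V₂ ⊗ ℂ)`; (IDEAL) puts `Θ₂` in `c₂(K)_ℂ`, (RIGID) makes `c₂(K)_ℂ`
everything, and descent gives rational preimages `ι₂ Z π₂ ∈ K`). [cite: MoonenZarhin1999LowDim, §3 (3.1) and Thm. (3.2)(1)]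
[cite: Hazama1989, Thm. (= Gordon 7.6.2)] [cite: Deligne1982HodgeCycles, I §3 (proof of Prop. 3.4)] -/
theorem goursat_incl_corner_mem (H₂ : HodgeStructure V₂ n)
    {ι₁ : V₁ →ₗ[ℚ] U} {π₁ : U →ₗ[ℚ] V₁} {ι₂ : V₂ →ₗ[ℚ] U} {π₂ : U →ₗ[ℚ] V₂}
    (hπι₁ : π₁ ∘ₗ ι₁ = LinearMap.id) (hπι₂ : π₂ ∘ₗ ι₂ = LinearMap.id) (hπ₁ι₂ : π₁ ∘ₗ ι₂ = 0)
    (hπ₂ι₁ : π₂ ∘ₗ ι₁ = 0) (hsum : ι₁ ∘ₗ π₁ + ι₂ ∘ₗ π₂ = LinearMap.id)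
    (𝔞 : Submodule ℚ (Module.End ℚ U)) (hbr : ∀ X ∈ 𝔞, ∀ X' ∈ 𝔞, X * X' - X' * X ∈ 𝔞)
    (hP₁ : ∀ X ∈ 𝔞, X * (ι₁ ∘ₗ π₁) = (ι₁ ∘ₗ π₁) * X) (hP₂ : ∀ X ∈ 𝔞, X * (ι₂ ∘ₗ π₂) = (ι₂ ∘ₗ π₂) * X)
    (ψ₂ : H₂.Polarization)
    (hskew₂ : ∀ X ∈ 𝔞, ∀ v w, ψ₂.form ((π₂ ∘ₗ X ∘ₗ ι₂) v) w + ψ₂.form v ((π₂ ∘ₗ X ∘ₗ ι₂) w) = 0)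
    {Θ₂ : Module.End ℂ (ℂ ⊗[ℚ] V₂)}
    (hΘ₂ : Θ₂ ∈ Submodule.span ℂ ((fun X : Module.End ℚ U => (π₂ ∘ₗ X ∘ₗ ι₂).baseChange ℂ) '' (𝔞 : Set _)))
    (hrigid : ∀ 𝔤₂ : Submodule ℚ (Module.End ℚ V₂), (∀ X ∈ 𝔤₂, ∀ X' ∈ 𝔤₂, X * X' - X' * X ∈ 𝔤₂) →
      (∀ X ∈ 𝔤₂, ∀ v w, ψ₂.form (X v) w + ψ₂.form v (X w) = 0) → Θ₂ ∈ spanC 𝔤₂ →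
      ∀ Y : Module.End ℂ (ℂ ⊗[ℚ] V₂),
        (∀ x y, ψ₂.form.baseChange ℂ (Y x) y + ψ₂.form.baseChange ℂ x (Y y) = 0) → Y ∈ spanC 𝔤₂)
    (hideal : ∀ I : Submodule ℂ (Module.End ℂ (ℂ ⊗[ℚ] V₂)),
      (∀ Y ∈ I, ∀ x y, ψ₂.form.baseChange ℂ (Y x) y + ψ₂.form.baseChange ℂ x (Y y) = 0) →
      (∀ Zc : Module.End ℂ (ℂ ⊗[ℚ] V₂),
        (∀ x y, ψ₂.form.baseChange ℂ (Zc x) y + ψ₂.form.baseChange ℂ x (Zc y) = 0) →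
          ∀ Y ∈ I, Zc * Y - Y * Zc ∈ I) → I ≠ ⊥ → Θ₂ ∈ I)
    {r : ℕ} (hdim : ∀ 𝔤₁ : Submodule ℚ (Module.End ℚ V₁),
      (∀ Y ∈ 𝔤₁, ∃ X ∈ 𝔞, π₁ ∘ₗ X ∘ₗ ι₁ = Y) → Module.finrank ℚ 𝔤₁ < r)
    (Z : Fin r → Module.End ℂ (ℂ ⊗[ℚ] V₂)) (hZind : LinearIndependent ℂ Z)
    (hZskew : ∀ i x y, ψ₂.form.baseChange ℂ (Z i x) y + ψ₂.form.baseChange ℂ x (Z i y) = 0) :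
    (∀ X ∈ 𝔞, ι₁ ∘ₗ (π₁ ∘ₗ X ∘ₗ ι₁) ∘ₗ π₁ ∈ 𝔞) ∧
      ∀ Z₂ : Module.End ℚ V₂, (∀ v w, ψ₂.form (Z₂ v) w + ψ₂.form v (Z₂ w) = 0) → ι₂ ∘ₗ Z₂ ∘ₗ π₂ ∈ 𝔞 := by
  classical
  have hsum' : ι₂ ∘ₗ π₂ + ι₁ ∘ₗ π₁ = LinearMap.id := by rw [add_comm]; exact hsum
  -- the corner maps as linear maps
  obtain ⟨cL₁, hcL₁⟩ : ∃ L : Module.End ℚ U →ₗ[ℚ] Module.End ℚ V₁, ∀ X, L X = π₁ ∘ₗ X ∘ₗ ι₁ :=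
    ⟨{ toFun := fun X => π₁ ∘ₗ X ∘ₗ ι₁
       map_add' := fun X X' => by rw [LinearMap.add_comp, LinearMap.comp_add]
       map_smul' := fun c X => by rw [LinearMap.smul_comp, LinearMap.comp_smul, RingHom.id_apply] },
      fun X => rfl⟩
  obtain ⟨cL₂, hcL₂⟩ : ∃ L : Module.End ℚ U →ₗ[ℚ] Module.End ℚ V₂, ∀ X, L X = π₂ ∘ₗ X ∘ₗ ι₂ :=
    ⟨{ toFun := fun X => π₂ ∘ₗ X ∘ₗ ι₂
       map_add' := fun X X' => by rw [LinearMap.add_comp, LinearMap.comp_add]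
       map_smul' := fun c X => by rw [LinearMap.smul_comp, LinearMap.comp_smul, RingHom.id_apply] },
      fun X => rfl⟩
  -- corners of brackets
  have hc₁br : ∀ X ∈ 𝔞, ∀ X' ∈ 𝔞, π₁ ∘ₗ (X * X' - X' * X) ∘ₗ ι₁ =
      (π₁ ∘ₗ X ∘ₗ ι₁) * (π₁ ∘ₗ X' ∘ₗ ι₁) - (π₁ ∘ₗ X' ∘ₗ ι₁) * (π₁ ∘ₗ X ∘ₗ ι₁) := fun X hX X' hX' =>
    corner_bracket hπι₁ hπι₂ hπ₁ι₂ hsum (hP₁ X hX) (hP₂ X hX) (hP₁ X' hX') (hP₂ X' hX')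
  have hc₂br : ∀ X ∈ 𝔞, ∀ X' ∈ 𝔞, π₂ ∘ₗ (X * X' - X' * X) ∘ₗ ι₂ =
      (π₂ ∘ₗ X ∘ₗ ι₂) * (π₂ ∘ₗ X' ∘ₗ ι₂) - (π₂ ∘ₗ X' ∘ₗ ι₂) * (π₂ ∘ₗ X ∘ₗ ι₂) := fun X hX X' hX' =>
    corner_bracket hπι₂ hπι₁ hπ₂ι₁ hsum' (hP₂ X hX) (hP₁ X hX) (hP₂ X' hX') (hP₁ X' hX')
  -- the second corner algebra `𝔤₂ = c₂(𝔞)`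
  set 𝔤₂ : Submodule ℚ (Module.End ℚ V₂) := 𝔞.map cL₂ with h𝔤₂
  have h𝔤₂mem : ∀ {Y}, Y ∈ 𝔤₂ ↔ ∃ X ∈ 𝔞, π₂ ∘ₗ X ∘ₗ ι₂ = Y := by
    intro Y
    rw [h𝔤₂, Submodule.mem_map]
    simp only [hcL₂]
  have hbr𝔤₂ : ∀ Y ∈ 𝔤₂, ∀ Y' ∈ 𝔤₂, Y * Y' - Y' * Y ∈ 𝔤₂ := by
    intro Y hY Y' hY'
    obtain ⟨X, hX, rfl⟩ := h𝔤₂mem.1 hY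
    obtain ⟨X', hX', rfl⟩ := h𝔤₂mem.1 hY'
    exact h𝔤₂mem.2 ⟨_, hbr X hX X' hX', hc₂br X hX X' hX'⟩
  have hskew𝔤₂ : ∀ Y ∈ 𝔤₂, ∀ v w, ψ₂.form (Y v) w + ψ₂.form v (Y w) = 0 := by
    intro Y hY v w
    obtain ⟨X, hX, rfl⟩ := h𝔤₂mem.1 hY
    exact hskew₂ X hX v w
  have hspanC𝔤₂ : spanC 𝔤₂ = Submodule.span ℂ
      ((fun X : Module.End ℚ U => (π₂ ∘ₗ X ∘ₗ ι₂).baseChange ℂ) '' (𝔞 : Set _)) := by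
    rw [spanC, h𝔤₂, Submodule.map_coe, Set.image_image]
    simp only [hcL₂]
  have hΘ𝔤₂ : Θ₂ ∈ spanC 𝔤₂ := by rw [hspanC𝔤₂]; exact hΘ₂
  -- (RIGID) for `𝔤₂`: its complex span is everything skew
  have hfull₂ : ∀ Y : Module.End ℂ (ℂ ⊗[ℚ] V₂),
      (∀ x y, ψ₂.form.baseChange ℂ (Y x) y + ψ₂.form.baseChange ℂ x (Y y) = 0) → Y ∈ spanC 𝔤₂ :=
    hrigid 𝔤₂ hbr𝔤₂ hskew𝔤₂ hΘ𝔤₂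
  -- the kernel `K = 𝔞 ∩ ker c₁`
  set K : Submodule ℚ (Module.End ℚ U) := 𝔞 ⊓ LinearMap.ker cL₁ with hK
  have hKmem : ∀ {X}, X ∈ K ↔ X ∈ 𝔞 ∧ π₁ ∘ₗ X ∘ₗ ι₁ = 0 := by
    intro X
    rw [hK, Submodule.mem_inf, LinearMap.mem_ker, hcL₁]
  have hKideal : ∀ X' ∈ 𝔞, ∀ X ∈ K, X' * X - X * X' ∈ K := by
    intro X' hX' X hX
    obtain ⟨hX𝔞, hc₁X⟩ := hKmem.1 hX
    refine hKmem.2 ⟨hbr X' hX' X hX𝔞, ?_⟩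
    rw [hc₁br X' hX' X hX𝔞, hc₁X, mul_zero, zero_mul, sub_zero]
  -- `K ≠ 0` by the dimension count
  have hK0 : K ≠ ⊥ := by
    intro hKbot
    have hinj : ∀ X ∈ 𝔞, cL₁ X = 0 → X = 0 := fun X hX h0 => by
      have hXK : X ∈ K := hKmem.2 ⟨hX, by rw [← hcL₁]; exact h0⟩
      rw [hKbot] at hXK
      exact (Submodule.mem_bot ℚ).1 hXK
    have hker : LinearMap.ker (cL₁.domRestrict 𝔞) = ⊥ := by
      rw [eq_bot_iff]
      rintro ⟨X, hX⟩ h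
      rw [LinearMap.mem_ker, LinearMap.domRestrict_apply] at h
      rw [Submodule.mem_bot]
      exact Subtype.ext (hinj X hX h)
    have hrn := LinearMap.finrank_range_add_finrank_ker (cL₁.domRestrict 𝔞)
    rw [hker, finrank_bot, add_zero, LinearMap.range_domRestrict] at hrn
    have h1 : Module.finrank ℚ 𝔞 < r := by
      rw [← hrn]
      refine hdim _ fun Y hY => ?_
      obtain ⟨X, hX, rfl⟩ := Submodule.mem_map.1 hY
      exact ⟨X, hX, (hcL₁ X).symm⟩
    have h2 : r ≤ Module.finrank ℂ (spanC 𝔤₂) := by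
      have hZmem : ∀ i, Z i ∈ spanC 𝔤₂ := fun i => hfull₂ (Z i) (hZskew i)
      have hind : LinearIndependent ℂ (fun i => (⟨Z i, hZmem i⟩ : spanC 𝔤₂)) :=
        LinearIndependent.of_comp (spanC 𝔤₂).subtype (by exact hZind)
      have h := hind.fintype_card_le_finrank
      rwa [Fintype.card_fin] at h
    have h3 : Module.finrank ℂ (spanC 𝔤₂) ≤ Module.finrank ℚ 𝔤₂ := finrank_spanC_le 𝔤₂
    have h4 : Module.finrank ℚ 𝔤₂ ≤ Module.finrank ℚ 𝔞 := Submodule.finrank_map_le cL₂ 𝔞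
    omega
  obtain ⟨X₀, hX₀K, hX₀ne⟩ := (Submodule.ne_bot_iff K).1 hK0
  -- the ideal `c₂(K)` and its complex span
  set 𝔤K : Submodule ℚ (Module.End ℚ V₂) := K.map cL₂ with h𝔤K
  have h𝔤Kmem : ∀ {Y}, Y ∈ 𝔤K ↔ ∃ X ∈ K, π₂ ∘ₗ X ∘ₗ ι₂ = Y := by
    intro Y
    rw [h𝔤K, Submodule.mem_map]
    simp only [hcL₂]
  have h𝔤Kle : 𝔤K ≤ 𝔤₂ := Submodule.map_mono inf_le_left
  have hideal𝔤K : ∀ Y ∈ 𝔤₂, ∀ Y' ∈ 𝔤K, Y * Y' - Y' * Y ∈ 𝔤K := by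
    intro Y hY Y' hY'
    obtain ⟨X, hX, rfl⟩ := h𝔤₂mem.1 hY
    obtain ⟨X', hX', rfl⟩ := h𝔤Kmem.1 hY'
    exact h𝔤Kmem.2 ⟨_, hKideal X hX X' hX', hc₂br X hX X' (hKmem.1 hX').1⟩
  have hskew𝔤K : ∀ Y ∈ 𝔤K, ∀ v w, ψ₂.form (Y v) w + ψ₂.form v (Y w) = 0 :=
    fun Y hY => hskew𝔤₂ Y (h𝔤Kle hY)
  have hc₂X₀ : π₂ ∘ₗ X₀ ∘ₗ ι₂ ≠ 0 := by
    intro h0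
    obtain ⟨hX₀𝔞, hc₁X₀⟩ := hKmem.1 hX₀K
    apply hX₀ne
    rw [eq_incl_corner_add hπι₁ hπι₂ hsum (hP₁ X₀ hX₀𝔞) (hP₂ X₀ hX₀𝔞), hc₁X₀, h0]
    simp only [LinearMap.zero_comp, LinearMap.comp_zero, add_zero]
  have hI0 : spanC 𝔤K ≠ ⊥ := by
    intro hbot
    apply hc₂X₀
    have hmem : (π₂ ∘ₗ X₀ ∘ₗ ι₂).baseChange ℂ ∈ spanC 𝔤K := baseChange_mem_spanC (h𝔤Kmem.2 ⟨X₀, hX₀K, rfl⟩)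
    rw [hbot, Submodule.mem_bot] at hmem
    have h : π₂ ∘ₗ X₀ ∘ₗ ι₂ ∈ (⊥ : Submodule ℚ (Module.End ℚ V₂)) :=
      mem_of_baseChange_mem_spanC ⊥ (by rw [hmem]; exact Submodule.zero_mem _)
    exact (Submodule.mem_bot ℚ).1 h
  have hIskew : ∀ Y ∈ spanC 𝔤K, ∀ x y, ψ₂.form.baseChange ℂ (Y x) y + ψ₂.form.baseChange ℂ x (Y y) = 0 :=
    fun Y hY => ThetaSubalgebra.formBaseChange_add_eq_zero_of_mem_spanC ψ₂ hskew𝔤K hY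
  have hIideal : ∀ Zc : Module.End ℂ (ℂ ⊗[ℚ] V₂),
      (∀ x y, ψ₂.form.baseChange ℂ (Zc x) y + ψ₂.form.baseChange ℂ x (Zc y) = 0) →
        ∀ Y ∈ spanC 𝔤K, Zc * Y - Y * Zc ∈ spanC 𝔤K :=
    fun Zc hZc Y hY => bracket_mem_spanC_of_forall hideal𝔤K (hfull₂ Zc hZc) hY
  -- (IDEAL): `Θ₂ ∈ c₂(K)_ℂ`; (RIGID): `c₂(K)_ℂ` is everything skew
  have hΘK : Θ₂ ∈ spanC 𝔤K := hideal _ hIskew hIideal hI0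
  have hbr𝔤K : ∀ Y ∈ 𝔤K, ∀ Y' ∈ 𝔤K, Y * Y' - Y' * Y ∈ 𝔤K := fun Y hY Y' hY' =>
    hideal𝔤K Y (h𝔤Kle hY) Y' hY'
  have hfullK : ∀ Y : Module.End ℂ (ℂ ⊗[ℚ] V₂),
      (∀ x y, ψ₂.form.baseChange ℂ (Y x) y + ψ₂.form.baseChange ℂ x (Y y) = 0) → Y ∈ spanC 𝔤K :=
    hrigid 𝔤K hbr𝔤K hskew𝔤K hΘK
  -- descent: every rational skew `Z₂` is `c₂` of an element `ι₂ Z₂ π₂` of `K`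
  have hconcl₂ : ∀ Z₂ : Module.End ℚ V₂, (∀ v w, ψ₂.form (Z₂ v) w + ψ₂.form v (Z₂ w) = 0) →
      ι₂ ∘ₗ Z₂ ∘ₗ π₂ ∈ 𝔞 := by
    intro Z₂ hZ₂
    have hmemC : Z₂.baseChange ℂ ∈ spanC 𝔤K :=
      hfullK _ (ThetaSubalgebra.formBaseChange_add_eq_zero_of_skew ψ₂ hZ₂)
    obtain ⟨X, hXK, hXeq⟩ := h𝔤Kmem.1 (mem_of_baseChange_mem_spanC 𝔤K hmemC)
    obtain ⟨hX𝔞, hc₁X⟩ := hKmem.1 hXK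
    have hdec := eq_incl_corner_add hπι₁ hπι₂ hsum (hP₁ X hX𝔞) (hP₂ X hX𝔞)
    rw [hc₁X, hXeq] at hdec
    simp only [LinearMap.zero_comp, LinearMap.comp_zero, zero_add] at hdec
    rw [← hdec]
    exact hX𝔞
  refine ⟨fun X hX => ?_, hconcl₂⟩
  have hdec := eq_incl_corner_add hπι₁ hπι₂ hsum (hP₁ X hX) (hP₂ X hX)
  have h2 : ι₂ ∘ₗ (π₂ ∘ₗ X ∘ₗ ι₂) ∘ₗ π₂ ∈ 𝔞 := hconcl₂ _ (hskew₂ X hX)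
  have heq : ι₁ ∘ₗ (π₁ ∘ₗ X ∘ₗ ι₁) ∘ₗ π₁ = X - ι₂ ∘ₗ (π₂ ∘ₗ X ∘ₗ ι₂) ∘ₗ π₂ :=
    eq_sub_of_add_eq hdec.symm
  rw [heq]
  exact Submodule.sub_mem _ hX h2

end Goursat

/-! ### §3 The theorems: `⊕_i 𝔰𝔩(T_{σ_i}) ⊕ 0` and `0 ⊕ 𝔰𝔭(V₂ ⊗ ℂ)` kill every rational tensor killed by `Θ_U` -/

section Main

universe u

variable {U V₁ V₂ : Type u} [AddCommGroup U] [Module ℚ U] [AddCommGroup V₁] [Module ℚ V₁]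
  [AddCommGroup V₂] [Module ℚ V₂] [Module.Finite ℚ U] [Module.Finite ℚ V₁] [Module.Finite ℚ V₂]
  [HodgeTensorFacts.{u, u}] {n : ℤ}
variable {M d m : ℕ}

/-- **The core of both theorems**: for the annihilator algebra `𝔞 = annLie φ eQ aF q` of a rational tensor `q`
on `U = ι₁V₁ ⊕ ι₂V₂` killed by `Θ_U` (`φ = ψ₁(π₁·,π₁·) + ψ₂(π₂·,π₂·)`; `aF` = the Hodge endomorphisms
`ι₁ a π₁`, `a ∈ End_Hdg(V₁)`, and the two projectors), under (RIGID), (IDEAL), (SIZE) for `V₂`: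
`ι₁ c₁X π₁ ∈ 𝔞` for all `X ∈ 𝔞`, `ι₂ Z π₂ ∈ 𝔞` for all rational `ψ₂`-skew `Z`, and `Θ_U ∈ 𝔞_ℂ`.
[cite: MoonenZarhin1999LowDim, §3 (3.1) and Thm. (3.2)(1)] [cite: Deligne1982HodgeCycles, I §3 (proof of Prop. 3.4)] -/
theorem incl_corner_mem_annLie_of_realBlocks_times_symplectic (HU : HodgeStructure U n)
    (H₁ : HodgeStructure V₁ n) (H₂ : HodgeStructure V₂ n)
    {ι₁ : V₁ →ₗ[ℚ] U} {π₁ : U →ₗ[ℚ] V₁} {ι₂ : V₂ →ₗ[ℚ] U} {π₂ : U →ₗ[ℚ] V₂}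
    (hπι₁ : π₁ ∘ₗ ι₁ = LinearMap.id) (hπι₂ : π₂ ∘ₗ ι₂ = LinearMap.id) (hπ₁ι₂ : π₁ ∘ₗ ι₂ = 0)
    (hπ₂ι₁ : π₂ ∘ₗ ι₁ = 0) (hsum : ι₁ ∘ₗ π₁ + ι₂ ∘ₗ π₂ = LinearMap.id)
    (hι₁F : ∀ p, ∀ x ∈ H₁.piece p (n - p), ι₁.baseChange ℂ x ∈ HU.piece p (n - p))
    (hι₂F : ∀ p, ∀ x ∈ H₂.piece p (n - p), ι₂.baseChange ℂ x ∈ HU.piece p (n - p))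
    (ψ₁ : H₁.Polarization) (ψ₂ : H₂.Polarization) {Θ₂ : Module.End ℂ (ℂ ⊗[ℚ] V₂)}
    (hΘ₂ : ∀ p, ∀ x ∈ H₂.piece p (n - p), Θ₂ x = ((2 * p - n : ℤ) : ℂ) • x)
    (hrigid : ∀ 𝔤₂ : Submodule ℚ (Module.End ℚ V₂), (∀ X ∈ 𝔤₂, ∀ X' ∈ 𝔤₂, X * X' - X' * X ∈ 𝔤₂) →
      (∀ X ∈ 𝔤₂, ∀ v w, ψ₂.form (X v) w + ψ₂.form v (X w) = 0) → Θ₂ ∈ spanC 𝔤₂ →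
      ∀ Y : Module.End ℂ (ℂ ⊗[ℚ] V₂),
        (∀ x y, ψ₂.form.baseChange ℂ (Y x) y + ψ₂.form.baseChange ℂ x (Y y) = 0) → Y ∈ spanC 𝔤₂)
    (hideal : ∀ I : Submodule ℂ (Module.End ℂ (ℂ ⊗[ℚ] V₂)),
      (∀ Y ∈ I, ∀ x y, ψ₂.form.baseChange ℂ (Y x) y + ψ₂.form.baseChange ℂ x (Y y) = 0) →
      (∀ Zc : Module.End ℂ (ℂ ⊗[ℚ] V₂),
        (∀ x y, ψ₂.form.baseChange ℂ (Zc x) y + ψ₂.form.baseChange ℂ x (Zc y) = 0) →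
          ∀ Y ∈ I, Zc * Y - Y * Zc ∈ I) → I ≠ ⊥ → Θ₂ ∈ I)
    {r : ℕ} (hdim : ∀ 𝔤₁ : Submodule ℚ (Module.End ℚ V₁),
      (∀ Y ∈ 𝔤₁, ∀ a : H₁.endAlg, Y * (a : Module.End ℚ V₁) = (a : Module.End ℚ V₁) * Y) →
      (∀ Y ∈ 𝔤₁, ∀ v w, ψ₁.form (Y v) w + ψ₁.form v (Y w) = 0) → Module.finrank ℚ 𝔤₁ < r)
    (Z : Fin r → Module.End ℂ (ℂ ⊗[ℚ] V₂)) (hZind : LinearIndependent ℂ Z)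
    (hZskew : ∀ i x y, ψ₂.form.baseChange ℂ (Z i x) y + ψ₂.form.baseChange ℂ x (Z i y) = 0)
    (eQ : Module.Basis (Fin M) ℚ U) (q : (Fin d → Fin m × Fin M) → ℚ)
    {ΘU : Module.End ℂ (ℂ ⊗[ℚ] U)} (hΘU : ∀ p, ∀ x ∈ HU.piece p (n - p), ΘU x = ((2 * p - n : ℤ) : ℂ) • x)
    (hΘq : ∀ u : Fin d → Fin m, wordDerAt ℂ (fun _ : Fin d =>
      LinearMap.toMatrix (Algebra.TensorProduct.basis ℂ eQ) (Algebra.TensorProduct.basis ℂ eQ) ΘU)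
      (wordSlice (fun w => algebraMap ℚ ℂ (q w)) u) = 0) :
    (∀ X ∈ annLie (ψ₁.form.compl₁₂ π₁ π₁ + ψ₂.form.compl₁₂ π₂ π₂) eQ
        (Sum.elim (fun a : H₁.endAlg => ι₁ ∘ₗ (a : Module.End ℚ V₁) ∘ₗ π₁)
          (Sum.elim (fun _ : Unit => ι₁ ∘ₗ π₁) (fun _ : Unit => ι₂ ∘ₗ π₂))) q,
      ι₁ ∘ₗ (π₁ ∘ₗ X ∘ₗ ι₁) ∘ₗ π₁ ∈ annLie (ψ₁.form.compl₁₂ π₁ π₁ + ψ₂.form.compl₁₂ π₂ π₂) eQ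
        (Sum.elim (fun a : H₁.endAlg => ι₁ ∘ₗ (a : Module.End ℚ V₁) ∘ₗ π₁)
          (Sum.elim (fun _ : Unit => ι₁ ∘ₗ π₁) (fun _ : Unit => ι₂ ∘ₗ π₂))) q) ∧
    (∀ Z₂ : Module.End ℚ V₂, (∀ v w, ψ₂.form (Z₂ v) w + ψ₂.form v (Z₂ w) = 0) →
      ι₂ ∘ₗ Z₂ ∘ₗ π₂ ∈ annLie (ψ₁.form.compl₁₂ π₁ π₁ + ψ₂.form.compl₁₂ π₂ π₂) eQ
        (Sum.elim (fun a : H₁.endAlg => ι₁ ∘ₗ (a : Module.End ℚ V₁) ∘ₗ π₁)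
          (Sum.elim (fun _ : Unit => ι₁ ∘ₗ π₁) (fun _ : Unit => ι₂ ∘ₗ π₂))) q) ∧
    ΘU ∈ spanC (annLie (ψ₁.form.compl₁₂ π₁ π₁ + ψ₂.form.compl₁₂ π₂ π₂) eQ
        (Sum.elim (fun a : H₁.endAlg => ι₁ ∘ₗ (a : Module.End ℚ V₁) ∘ₗ π₁)
          (Sum.elim (fun _ : Unit => ι₁ ∘ₗ π₁) (fun _ : Unit => ι₂ ∘ₗ π₂))) q) := by
  classical
  obtain ⟨Θ₁, hΘ₁⟩ := exists_hodgeTheta H₁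
  have hΘ₁C : Θ₁ ∈ H₁.hodgeLieC := H₁.mem_hodgeLieC_of_forall_piece hΘ₁
  have hΘ₂C : Θ₂ ∈ H₂.hodgeLieC := H₂.mem_hodgeLieC_of_forall_piece hΘ₂
  have hsum' : ι₂ ∘ₗ π₂ + ι₁ ∘ₗ π₁ = LinearMap.id := by rw [add_comm]; exact hsum
  have e11 : ∀ v, π₁ (ι₁ v) = v := fun v => by
    rw [← LinearMap.comp_apply (f := π₁), hπι₁, LinearMap.id_apply]
  have e22 : ∀ w, π₂ (ι₂ w) = w := fun w => by
    rw [← LinearMap.comp_apply (f := π₂), hπι₂, LinearMap.id_apply]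
  have e12 : ∀ w, π₁ (ι₂ w) = 0 := fun w => by
    rw [← LinearMap.comp_apply (f := π₁), hπ₁ι₂, LinearMap.zero_apply]
  have e21 : ∀ v, π₂ (ι₁ v) = 0 := fun v => by
    rw [← LinearMap.comp_apply (f := π₂), hπ₂ι₁, LinearMap.zero_apply]
  -- `Θ` through the presentation
  have hΘι₁ := theta_incl_eq HU H₁ hι₁F hΘU hΘ₁
  have hΘι₂ := theta_incl_eq HU H₂ hι₂F hΘU hΘ₂
  have hΘπ₁ := proj_theta_eq HU H₁ H₂ hπι₁ hπ₁ι₂ hsum hι₁F hι₂F hΘU hΘ₁ hΘ₂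
  have hΘπ₂ := proj_theta_eq HU H₂ H₁ hπι₂ hπ₂ι₁ hsum' hι₂F hι₁F hΘU hΘ₂ hΘ₁
  -- the commuting family and the orthogonal-sum form
  set aF : H₁.endAlg ⊕ (Unit ⊕ Unit) → Module.End ℚ U :=
    Sum.elim (fun a : H₁.endAlg => ι₁ ∘ₗ (a : Module.End ℚ V₁) ∘ₗ π₁)
      (Sum.elim (fun _ : Unit => ι₁ ∘ₗ π₁) (fun _ : Unit => ι₂ ∘ₗ π₂)) with haF
  set φ : LinearMap.BilinForm ℚ U := ψ₁.form.compl₁₂ π₁ π₁ + ψ₂.form.compl₁₂ π₂ π₂ with hφ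
  have hφC : ∀ x y, φ.baseChange ℂ x y = ψ₁.form.baseChange ℂ (π₁.baseChange ℂ x) (π₁.baseChange ℂ y) +
      ψ₂.form.baseChange ℂ (π₂.baseChange ℂ x) (π₂.baseChange ℂ y) := fun x y => by
    rw [hφ, baseChange_add_apply, baseChange_compl₁₂_apply, baseChange_compl₁₂_apply]
  have hφapply : ∀ x y, φ x y = ψ₁.form (π₁ x) (π₁ y) + ψ₂.form (π₂ x) (π₂ y) := fun x y => by
    rw [hφ, LinearMap.add_apply, LinearMap.add_apply, LinearMap.compl₁₂_apply, LinearMap.compl₁₂_apply]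
  set 𝔞 : Submodule ℚ (Module.End ℚ U) := annLie φ eQ aF q with h𝔞
  -- `Θ_U ∈ 𝔞_ℂ`
  have hΘ𝔞 : ΘU ∈ spanC 𝔞 := by
    refine mem_spanC_annLie φ eQ aF q hΘq (fun i => ?_) (fun x y => ?_)
    · apply LinearMap.ext
      intro y
      rcases i with a | (_ | _)
      · change ΘU ((ι₁ ∘ₗ (a : Module.End ℚ V₁) ∘ₗ π₁).baseChange ℂ y) =
          (ι₁ ∘ₗ (a : Module.End ℚ V₁) ∘ₗ π₁).baseChange ℂ (ΘU y)
        simp only [LinearMap.baseChange_comp, LinearMap.comp_apply]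
        rw [hΘι₁, ← Module.End.mul_apply (f := Θ₁), commute_baseChange_of_mem_hodgeLieC H₁ hΘ₁C a,
          Module.End.mul_apply, hΘπ₁]
      · change ΘU ((ι₁ ∘ₗ π₁).baseChange ℂ y) = (ι₁ ∘ₗ π₁).baseChange ℂ (ΘU y)
        simp only [LinearMap.baseChange_comp, LinearMap.comp_apply]
        rw [hΘι₁, hΘπ₁]
      · change ΘU ((ι₂ ∘ₗ π₂).baseChange ℂ y) = (ι₂ ∘ₗ π₂).baseChange ℂ (ΘU y)
        simp only [LinearMap.baseChange_comp, LinearMap.comp_apply]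
        rw [hΘι₂, hΘπ₂]
    · rw [hφC, hφC, hΘπ₁, hΘπ₁, hΘπ₂, hΘπ₂, formBaseChange_skew_of_mem_hodgeLieC ψ₁ hΘ₁C,
        formBaseChange_skew_of_mem_hodgeLieC ψ₂ hΘ₂C]
      ring
  -- what membership in `𝔞` gives
  have hbr𝔞 : ∀ X ∈ 𝔞, ∀ X' ∈ 𝔞, X * X' - X' * X ∈ 𝔞 := fun X hX X' hX' =>
    commutator_mem_annLie φ eQ aF q hX hX'
  have hmem : ∀ X ∈ 𝔞, (∀ i, X * aF i = aF i * X) ∧ ∀ v w, φ (X v) w + φ v (X w) = 0 :=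
    fun X hX => ((mem_annLie_iff φ eQ aF q X).1 hX).2
  have hP₁ : ∀ X ∈ 𝔞, X * (ι₁ ∘ₗ π₁) = (ι₁ ∘ₗ π₁) * X := fun X hX => (hmem X hX).1 (Sum.inr (Sum.inl ()))
  have hP₂ : ∀ X ∈ 𝔞, X * (ι₂ ∘ₗ π₂) = (ι₂ ∘ₗ π₂) * X := fun X hX => (hmem X hX).1 (Sum.inr (Sum.inr ()))
  have hTa : ∀ X ∈ 𝔞, ∀ a : H₁.endAlg, X * (ι₁ ∘ₗ (a : Module.End ℚ V₁) ∘ₗ π₁) =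
      (ι₁ ∘ₗ (a : Module.End ℚ V₁) ∘ₗ π₁) * X := fun X hX a => (hmem X hX).1 (Sum.inl a)
  have hc₁comm : ∀ X ∈ 𝔞, ∀ a : H₁.endAlg, (π₁ ∘ₗ X ∘ₗ ι₁) * (a : Module.End ℚ V₁) =
      (a : Module.End ℚ V₁) * (π₁ ∘ₗ X ∘ₗ ι₁) := by
    intro X hX a
    apply LinearMap.ext
    intro v
    have h := congrArg (fun f : Module.End ℚ U => π₁ (f (ι₁ v))) (hTa X hX a)
    simp only [Module.End.mul_apply, LinearMap.comp_apply, e11] at h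
    simp only [Module.End.mul_apply, LinearMap.comp_apply]
    exact h
  have hc₁skew : ∀ X ∈ 𝔞, ∀ v w, ψ₁.form ((π₁ ∘ₗ X ∘ₗ ι₁) v) w + ψ₁.form v ((π₁ ∘ₗ X ∘ₗ ι₁) w) = 0 := by
    intro X hX v w
    have h := (hmem X hX).2 (ι₁ v) (ι₁ w)
    rw [apply_incl_eq_of_commute_projector hπι₁ (hP₁ X hX) v,
      apply_incl_eq_of_commute_projector hπι₁ (hP₁ X hX) w, hφapply, hφapply] at h
    simp only [e11, e21, map_zero, add_zero] at h
    simpa only [LinearMap.comp_apply] using h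
  have hc₂skew : ∀ X ∈ 𝔞, ∀ v w, ψ₂.form ((π₂ ∘ₗ X ∘ₗ ι₂) v) w + ψ₂.form v ((π₂ ∘ₗ X ∘ₗ ι₂) w) = 0 := by
    intro X hX v w
    have h := (hmem X hX).2 (ι₂ v) (ι₂ w)
    rw [apply_incl_eq_of_commute_projector hπι₂ (hP₂ X hX) v,
      apply_incl_eq_of_commute_projector hπι₂ (hP₂ X hX) w, hφapply, hφapply] at h
    simp only [e22, e12, map_zero, zero_add] at h
    simpa only [LinearMap.comp_apply] using h
  -- `Θ₂ = c₂(Θ_U)` lies in the complex span of the second corners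
  have hcorner₂ : ∀ T ∈ spanC 𝔞, π₂.baseChange ℂ ∘ₗ T ∘ₗ ι₂.baseChange ℂ ∈
      Submodule.span ℂ ((fun X : Module.End ℚ U => (π₂ ∘ₗ X ∘ₗ ι₂).baseChange ℂ) '' (𝔞 : Set _)) := by
    intro T hT
    induction hT using Submodule.span_induction with
    | mem Z' hZ' =>
      obtain ⟨X, hX, rfl⟩ := hZ'
      rw [← LinearMap.baseChange_comp, ← LinearMap.baseChange_comp]
      exact Submodule.subset_span ⟨X, hX, rfl⟩
    | zero => rw [LinearMap.zero_comp, LinearMap.comp_zero]; exact Submodule.zero_mem _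
    | add Z' Z'' _ _ hZ' hZ'' => rw [LinearMap.add_comp, LinearMap.comp_add]; exact Submodule.add_mem _ hZ' hZ''
    | smul c Z' _ hZ' => rw [LinearMap.smul_comp, LinearMap.comp_smul]; exact Submodule.smul_mem _ c hZ'
  have hΘ₂corner : Θ₂ ∈
      Submodule.span ℂ ((fun X : Module.End ℚ U => (π₂ ∘ₗ X ∘ₗ ι₂).baseChange ℂ) '' (𝔞 : Set _)) := by
    have h : Θ₂ = π₂.baseChange ℂ ∘ₗ ΘU ∘ₗ ι₂.baseChange ℂ := by
      apply LinearMap.ext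
      intro x
      rw [LinearMap.comp_apply, LinearMap.comp_apply, hΘι₂, proj_incl_baseChange hπι₂]
    rw [h]
    exact hcorner₂ ΘU hΘ𝔞
  -- (SIZE) in the form used by the Goursat step
  have hdim' : ∀ 𝔤₁ : Submodule ℚ (Module.End ℚ V₁),
      (∀ Y ∈ 𝔤₁, ∃ X ∈ 𝔞, π₁ ∘ₗ X ∘ₗ ι₁ = Y) → Module.finrank ℚ 𝔤₁ < r := by
    intro 𝔤₁ h𝔤₁
    refine hdim 𝔤₁ (fun Y hY a => ?_) (fun Y hY v w => ?_)
    · obtain ⟨X, hX, rfl⟩ := h𝔤₁ Y hY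
      exact hc₁comm X hX a
    · obtain ⟨X, hX, rfl⟩ := h𝔤₁ Y hY
      exact hc₁skew X hX v w
  obtain ⟨h1, h2⟩ := goursat_incl_corner_mem H₂ hπι₁ hπι₂ hπ₁ι₂ hπ₂ι₁ hsum 𝔞 hbr𝔞 hP₁ hP₂ ψ₂ hc₂skew hΘ₂corner
    hrigid hideal hdim' Z hZind hZskew
  exact ⟨h1, h2, hΘ𝔞⟩

/-- **Theorem (Hazama 1989 / Moonen–Zarhin 1999 Thm. (3.2)(1), Lie step, in the word model; first factor).**
Let `U = ι₁V₁ ⊕ ι₂V₂` be a presentation compatible with Hodge structures `H_U`, `H₁`, `H₂` of the same odd weight.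
On `V₁`: a polarization `ψ₁` with `End_Hdg(V₁)` self-adjoint and real characters `σ` of `End_Hdg(V₁)` whose
two-dimensional eigenblocks decompose `V₁ ⊗ ℂ` (real `𝔰𝔩₂`-block data), with block bases `b`. On `V₂`: a
polarization `ψ₂` and a Hodge operator `Θ₂` satisfying (RIGID), (IDEAL) and (SIZE) (module docstring; all three
are theorems of the tree for a generic abelian surface or threefold and an elliptic-curve first factor). If a
RATIONAL coefficient tensor `q` on `U` is killed, slice by slice, by the matrix of `Θ_U`, then it is killed by
the matrix of `ι₁ ∘ Z ∘ π₁` for every block-diagonal `Z = assemble b N` with trace-free blocks `N`: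
`(⊕_i 𝔰𝔩(T_{σ_i})) ⊕ 0 ⊆ 𝔞(q)_ℂ` («`Hg(X₁ × X₂) = Hg(X₁) × Hg(X₂)`» read on tensors).
[cite: MoonenZarhin1999LowDim, §3 Thm. (3.2)(1)] [cite: Hazama1989, Thm. (= Gordon 7.6.2)]
[cite: Deligne1982HodgeCycles, I §3 (proof of Prop. 3.4)] [cite: Hazama1983, §3 (pp. 305–306)] -/
theorem wordDerAt_assemble_eq_zero_of_realBlocks_times_symplectic (hn : Odd n) (HU : HodgeStructure U n)
    (H₁ : HodgeStructure V₁ n) (H₂ : HodgeStructure V₂ n)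
    {ι₁ : V₁ →ₗ[ℚ] U} {π₁ : U →ₗ[ℚ] V₁} {ι₂ : V₂ →ₗ[ℚ] U} {π₂ : U →ₗ[ℚ] V₂}
    (hπι₁ : π₁ ∘ₗ ι₁ = LinearMap.id) (hπι₂ : π₂ ∘ₗ ι₂ = LinearMap.id) (hπ₁ι₂ : π₁ ∘ₗ ι₂ = 0)
    (hπ₂ι₁ : π₂ ∘ₗ ι₁ = 0) (hsum : ι₁ ∘ₗ π₁ + ι₂ ∘ₗ π₂ = LinearMap.id)
    (hι₁F : ∀ p, ∀ x ∈ H₁.piece p (n - p), ι₁.baseChange ℂ x ∈ HU.piece p (n - p))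
    (hι₂F : ∀ p, ∀ x ∈ H₂.piece p (n - p), ι₂.baseChange ℂ x ∈ HU.piece p (n - p))
    {ι : Type*} [Fintype ι] [DecidableEq ι] (ψ₁ : H₁.Polarization)
    (hself₁ : ∀ a : H₁.endAlg,
      LinearMap.IsAdjointPair ψ₁.form ψ₁.form (a : Module.End ℚ V₁) (a : Module.End ℚ V₁))
    (σ : ι → (H₁.endAlg →+* ℂ)) (hreal : ∀ i, (starRingEnd ℂ).comp (σ i) = σ i)
    (hint : DirectSum.IsInternal fun i => H₁.eigenBlock (σ i))
    (h2 : ∀ i, Module.finrank ℂ (H₁.eigenBlock (σ i)) = 2)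
    (b : ∀ i, Module.Basis (Fin 2) ℂ (H₁.eigenBlock (σ i)))
    (ψ₂ : H₂.Polarization) {Θ₂ : Module.End ℂ (ℂ ⊗[ℚ] V₂)}
    (hΘ₂ : ∀ p, ∀ x ∈ H₂.piece p (n - p), Θ₂ x = ((2 * p - n : ℤ) : ℂ) • x)
    (hrigid : ∀ 𝔤₂ : Submodule ℚ (Module.End ℚ V₂), (∀ X ∈ 𝔤₂, ∀ X' ∈ 𝔤₂, X * X' - X' * X ∈ 𝔤₂) →
      (∀ X ∈ 𝔤₂, ∀ v w, ψ₂.form (X v) w + ψ₂.form v (X w) = 0) → Θ₂ ∈ spanC 𝔤₂ →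
      ∀ Y : Module.End ℂ (ℂ ⊗[ℚ] V₂),
        (∀ x y, ψ₂.form.baseChange ℂ (Y x) y + ψ₂.form.baseChange ℂ x (Y y) = 0) → Y ∈ spanC 𝔤₂)
    (hideal : ∀ I : Submodule ℂ (Module.End ℂ (ℂ ⊗[ℚ] V₂)),
      (∀ Y ∈ I, ∀ x y, ψ₂.form.baseChange ℂ (Y x) y + ψ₂.form.baseChange ℂ x (Y y) = 0) →
      (∀ Zc : Module.End ℂ (ℂ ⊗[ℚ] V₂),
        (∀ x y, ψ₂.form.baseChange ℂ (Zc x) y + ψ₂.form.baseChange ℂ x (Zc y) = 0) →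
          ∀ Y ∈ I, Zc * Y - Y * Zc ∈ I) → I ≠ ⊥ → Θ₂ ∈ I)
    {r : ℕ} (hdim : ∀ 𝔤₁ : Submodule ℚ (Module.End ℚ V₁),
      (∀ Y ∈ 𝔤₁, ∀ a : H₁.endAlg, Y * (a : Module.End ℚ V₁) = (a : Module.End ℚ V₁) * Y) →
      (∀ Y ∈ 𝔤₁, ∀ v w, ψ₁.form (Y v) w + ψ₁.form v (Y w) = 0) → Module.finrank ℚ 𝔤₁ < r)
    (Z : Fin r → Module.End ℂ (ℂ ⊗[ℚ] V₂)) (hZind : LinearIndependent ℂ Z)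
    (hZskew : ∀ i x y, ψ₂.form.baseChange ℂ (Z i x) y + ψ₂.form.baseChange ℂ x (Z i y) = 0)
    (eQ : Module.Basis (Fin M) ℚ U) (q : (Fin d → Fin m × Fin M) → ℚ)
    {ΘU : Module.End ℂ (ℂ ⊗[ℚ] U)} (hΘU : ∀ p, ∀ x ∈ HU.piece p (n - p), ΘU x = ((2 * p - n : ℤ) : ℂ) • x)
    (hΘq : ∀ u : Fin d → Fin m, wordDerAt ℂ (fun _ : Fin d =>
      LinearMap.toMatrix (Algebra.TensorProduct.basis ℂ eQ) (Algebra.TensorProduct.basis ℂ eQ) ΘU)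
      (wordSlice (fun w => algebraMap ℚ ℂ (q w)) u) = 0)
    (N : ι → Matrix (Fin 2) (Fin 2) ℂ) (hN : ∀ i, (N i).trace = 0) (u : Fin d → Fin m) :
    wordDerAt ℂ (fun _ : Fin d =>
      LinearMap.toMatrix (Algebra.TensorProduct.basis ℂ eQ) (Algebra.TensorProduct.basis ℂ eQ)
        (ι₁.baseChange ℂ ∘ₗ assemble hint b N ∘ₗ π₁.baseChange ℂ))
      (wordSlice (fun w => algebraMap ℚ ℂ (q w)) u) = 0 := by
  classical
  obtain ⟨Θ₁, hΘ₁⟩ := exists_hodgeTheta H₁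
  -- the annihilator algebra and the core
  set aF : H₁.endAlg ⊕ (Unit ⊕ Unit) → Module.End ℚ U :=
    Sum.elim (fun a : H₁.endAlg => ι₁ ∘ₗ (a : Module.End ℚ V₁) ∘ₗ π₁)
      (Sum.elim (fun _ : Unit => ι₁ ∘ₗ π₁) (fun _ : Unit => ι₂ ∘ₗ π₂)) with haF
  set φ : LinearMap.BilinForm ℚ U := ψ₁.form.compl₁₂ π₁ π₁ + ψ₂.form.compl₁₂ π₂ π₂ with hφ
  set 𝔞 : Submodule ℚ (Module.End ℚ U) := annLie φ eQ aF q with h𝔞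
  obtain ⟨h1, -, hΘ𝔞⟩ := incl_corner_mem_annLie_of_realBlocks_times_symplectic HU H₁ H₂ hπι₁ hπι₂ hπ₁ι₂ hπ₂ι₁
    hsum hι₁F hι₂F ψ₁ ψ₂ hΘ₂ hrigid hideal hdim Z hZind hZskew eQ q hΘU hΘq
  have e11 : ∀ v, π₁ (ι₁ v) = v := fun v => by
    rw [← LinearMap.comp_apply (f := π₁), hπι₁, LinearMap.id_apply]
  have e21 : ∀ v, π₂ (ι₁ v) = 0 := fun v => by
    rw [← LinearMap.comp_apply (f := π₂), hπ₂ι₁, LinearMap.zero_apply]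
  have hΘι₁ := theta_incl_eq HU H₁ hι₁F hΘU hΘ₁
  have hmem : ∀ X ∈ 𝔞, (∀ i, X * aF i = aF i * X) ∧ ∀ v w, φ (X v) w + φ v (X w) = 0 :=
    fun X hX => ((mem_annLie_iff φ eQ aF q X).1 hX).2
  have hP₁ : ∀ X ∈ 𝔞, X * (ι₁ ∘ₗ π₁) = (ι₁ ∘ₗ π₁) * X := fun X hX => (hmem X hX).1 (Sum.inr (Sum.inl ()))
  have hP₂ : ∀ X ∈ 𝔞, X * (ι₂ ∘ₗ π₂) = (ι₂ ∘ₗ π₂) * X := fun X hX => (hmem X hX).1 (Sum.inr (Sum.inr ()))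
  have hTa : ∀ X ∈ 𝔞, ∀ a : H₁.endAlg, X * (ι₁ ∘ₗ (a : Module.End ℚ V₁) ∘ₗ π₁) =
      (ι₁ ∘ₗ (a : Module.End ℚ V₁) ∘ₗ π₁) * X := fun X hX a => (hmem X hX).1 (Sum.inl a)
  have hφapply : ∀ x y, φ x y = ψ₁.form (π₁ x) (π₁ y) + ψ₂.form (π₂ x) (π₂ y) := fun x y => by
    rw [hφ, LinearMap.add_apply, LinearMap.add_apply, LinearMap.compl₁₂_apply, LinearMap.compl₁₂_apply]
  have hc₁comm : ∀ X ∈ 𝔞, ∀ a : H₁.endAlg, (π₁ ∘ₗ X ∘ₗ ι₁) * (a : Module.End ℚ V₁) =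
      (a : Module.End ℚ V₁) * (π₁ ∘ₗ X ∘ₗ ι₁) := by
    intro X hX a
    apply LinearMap.ext
    intro v
    have h := congrArg (fun f : Module.End ℚ U => π₁ (f (ι₁ v))) (hTa X hX a)
    simp only [Module.End.mul_apply, LinearMap.comp_apply, e11] at h
    simp only [Module.End.mul_apply, LinearMap.comp_apply]
    exact h
  have hc₁skew : ∀ X ∈ 𝔞, ∀ v w, ψ₁.form ((π₁ ∘ₗ X ∘ₗ ι₁) v) w + ψ₁.form v ((π₁ ∘ₗ X ∘ₗ ι₁) w) = 0 := by
    intro X hX v w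
    have h := (hmem X hX).2 (ι₁ v) (ι₁ w)
    rw [apply_incl_eq_of_commute_projector hπι₁ (hP₁ X hX) v,
      apply_incl_eq_of_commute_projector hπι₁ (hP₁ X hX) w, hφapply, hφapply] at h
    simp only [e11, e21, map_zero, add_zero] at h
    simpa only [LinearMap.comp_apply] using h
  -- the first corner algebra `𝔤 = c₁(𝔞)`
  obtain ⟨cLin, hcLin⟩ : ∃ L : Module.End ℚ U →ₗ[ℚ] Module.End ℚ V₁, ∀ X, L X = π₁ ∘ₗ X ∘ₗ ι₁ :=
    ⟨{ toFun := fun X => π₁ ∘ₗ X ∘ₗ ι₁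
       map_add' := fun X X' => by rw [LinearMap.add_comp, LinearMap.comp_add]
       map_smul' := fun c X => by rw [LinearMap.smul_comp, LinearMap.comp_smul, RingHom.id_apply] },
      fun X => rfl⟩
  set 𝔤 : Submodule ℚ (Module.End ℚ V₁) := 𝔞.map cLin with h𝔤
  have h𝔤mem : ∀ {Y}, Y ∈ 𝔤 ↔ ∃ X ∈ 𝔞, π₁ ∘ₗ X ∘ₗ ι₁ = Y := by
    intro Y
    rw [h𝔤, Submodule.mem_map]
    simp only [hcLin]
  have hbr𝔤 : ∀ Y ∈ 𝔤, ∀ Y' ∈ 𝔤, Y * Y' - Y' * Y ∈ 𝔤 := by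
    intro Y hY Y' hY'
    obtain ⟨X, hX, rfl⟩ := h𝔤mem.1 hY
    obtain ⟨X', hX', rfl⟩ := h𝔤mem.1 hY'
    exact h𝔤mem.2 ⟨_, commutator_mem_annLie φ eQ aF q hX hX',
      corner_bracket hπι₁ hπι₂ hπ₁ι₂ hsum (hP₁ X hX) (hP₂ X hX) (hP₁ X' hX') (hP₂ X' hX')⟩
  have hcomm𝔤 : ∀ Y ∈ 𝔤, ∀ a : H₁.endAlg, Y * (a : Module.End ℚ V₁) = (a : Module.End ℚ V₁) * Y := by
    intro Y hY a
    obtain ⟨X, hX, rfl⟩ := h𝔤mem.1 hY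
    exact hc₁comm X hX a
  have hskew𝔤 : ∀ Y ∈ 𝔤, ∀ v w, ψ₁.form (Y v) w + ψ₁.form v (Y w) = 0 := by
    intro Y hY v w
    obtain ⟨X, hX, rfl⟩ := h𝔤mem.1 hY
    exact hc₁skew X hX v w
  -- `Θ₁ = c₁(Θ_U) ∈ 𝔤_ℂ`
  have hcorner : ∀ T ∈ spanC 𝔞, π₁.baseChange ℂ ∘ₗ T ∘ₗ ι₁.baseChange ℂ ∈ spanC 𝔤 := by
    intro T hT
    induction hT using Submodule.span_induction with
    | mem Z' hZ' =>
      obtain ⟨X, hX, rfl⟩ := hZ'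
      rw [← LinearMap.baseChange_comp, ← LinearMap.baseChange_comp]
      exact baseChange_mem_spanC (h𝔤mem.2 ⟨X, hX, rfl⟩)
    | zero => rw [LinearMap.zero_comp, LinearMap.comp_zero]; exact Submodule.zero_mem _
    | add Z' Z'' _ _ hZ' hZ'' => rw [LinearMap.add_comp, LinearMap.comp_add]; exact Submodule.add_mem _ hZ' hZ''
    | smul c Z' _ hZ' => rw [LinearMap.smul_comp, LinearMap.comp_smul]; exact Submodule.smul_mem _ c hZ'
  have hΘ₁𝔤 : Θ₁ ∈ spanC 𝔤 := by
    have h : Θ₁ = π₁.baseChange ℂ ∘ₗ ΘU ∘ₗ ι₁.baseChange ℂ := by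
      apply LinearMap.ext
      intro x
      rw [LinearMap.comp_apply, LinearMap.comp_apply, hΘι₁, proj_incl_baseChange hπι₁]
    rw [h]
    exact hcorner ΘU hΘ𝔞
  -- the `Θ`-subalgebra theorem on `V₁`: `𝔤_ℂ ⊇ ⊕ 𝔰𝔩(T_σ)`
  have hZ' : assemble hint b N ∈ spanC 𝔤 :=
    (ThetaSubalgebra.mem_spanC_iff_mapsTo_and_skew H₁ hn ψ₁ hself₁ σ hreal hint h2 𝔤 hbr𝔤 hΘ₁ hΘ₁𝔤
      hcomm𝔤 hskew𝔤 _).2 ⟨assemble_mapsTo hint b N, formBaseChange_assemble_add_eq_zero H₁ hn ψ₁ hself₁ σ hint b N hN⟩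
  -- elements of `𝔤_ℂ`, placed on `V₁`, lie in `𝔞_ℂ`
  have hplace : ∀ Y ∈ spanC 𝔤, ι₁.baseChange ℂ ∘ₗ Y ∘ₗ π₁.baseChange ℂ ∈ spanC 𝔞 := by
    intro Y hY
    induction hY using Submodule.span_induction with
    | mem Y₁ hY₁ =>
      obtain ⟨Y₂, hY₂, rfl⟩ := hY₁
      obtain ⟨X, hX, rfl⟩ := h𝔤mem.1 hY₂
      rw [← LinearMap.baseChange_comp, ← LinearMap.baseChange_comp]
      exact baseChange_mem_spanC (h1 X hX)
    | zero => rw [LinearMap.zero_comp, LinearMap.comp_zero]; exact Submodule.zero_mem _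
    | add Y₁ Y₂ _ _ hY₁ hY₂ => rw [LinearMap.add_comp, LinearMap.comp_add]; exact Submodule.add_mem _ hY₁ hY₂
    | smul c Y₁ _ hY₁ => rw [LinearMap.smul_comp, LinearMap.comp_smul]; exact Submodule.smul_mem _ c hY₁
  exact wordDerAt_eq_zero_of_mem_spanC_annLie φ eQ aF q (hplace _ hZ') u

/-- **Theorem (second factor): the rational tensor is killed by `ι₂ ∘ Y ∘ π₂` for EVERY `ψ₂`-skew operator `Y`
of `V₂ ⊗ ℂ`** — `0 ⊕ 𝔰𝔭(V₂ ⊗ ℂ, ψ₂) ⊆ 𝔞(q)_ℂ` («`Hg(X₁ × X₂) ⊇ 1 × Hg(X₂) = 1 × Sp(V₂, ψ₂)`» read on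
tensors). [cite: MoonenZarhin1999LowDim, §3 Thm. (3.2)(1)] [cite: Hazama1989, Thm. (= Gordon 7.6.2)]
[cite: Deligne1982HodgeCycles, I §3 (proof of Prop. 3.4)] -/
theorem wordDerAt_incl₂_eq_zero_of_realBlocks_times_symplectic (HU : HodgeStructure U n)
    (H₁ : HodgeStructure V₁ n) (H₂ : HodgeStructure V₂ n)
    {ι₁ : V₁ →ₗ[ℚ] U} {π₁ : U →ₗ[ℚ] V₁} {ι₂ : V₂ →ₗ[ℚ] U} {π₂ : U →ₗ[ℚ] V₂}
    (hπι₁ : π₁ ∘ₗ ι₁ = LinearMap.id) (hπι₂ : π₂ ∘ₗ ι₂ = LinearMap.id) (hπ₁ι₂ : π₁ ∘ₗ ι₂ = 0)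
    (hπ₂ι₁ : π₂ ∘ₗ ι₁ = 0) (hsum : ι₁ ∘ₗ π₁ + ι₂ ∘ₗ π₂ = LinearMap.id)
    (hι₁F : ∀ p, ∀ x ∈ H₁.piece p (n - p), ι₁.baseChange ℂ x ∈ HU.piece p (n - p))
    (hι₂F : ∀ p, ∀ x ∈ H₂.piece p (n - p), ι₂.baseChange ℂ x ∈ HU.piece p (n - p))
    (ψ₁ : H₁.Polarization) (ψ₂ : H₂.Polarization) {Θ₂ : Module.End ℂ (ℂ ⊗[ℚ] V₂)}
    (hΘ₂ : ∀ p, ∀ x ∈ H₂.piece p (n - p), Θ₂ x = ((2 * p - n : ℤ) : ℂ) • x)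
    (hrigid : ∀ 𝔤₂ : Submodule ℚ (Module.End ℚ V₂), (∀ X ∈ 𝔤₂, ∀ X' ∈ 𝔤₂, X * X' - X' * X ∈ 𝔤₂) →
      (∀ X ∈ 𝔤₂, ∀ v w, ψ₂.form (X v) w + ψ₂.form v (X w) = 0) → Θ₂ ∈ spanC 𝔤₂ →
      ∀ Y : Module.End ℂ (ℂ ⊗[ℚ] V₂),
        (∀ x y, ψ₂.form.baseChange ℂ (Y x) y + ψ₂.form.baseChange ℂ x (Y y) = 0) → Y ∈ spanC 𝔤₂)
    (hideal : ∀ I : Submodule ℂ (Module.End ℂ (ℂ ⊗[ℚ] V₂)),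
      (∀ Y ∈ I, ∀ x y, ψ₂.form.baseChange ℂ (Y x) y + ψ₂.form.baseChange ℂ x (Y y) = 0) →
      (∀ Zc : Module.End ℂ (ℂ ⊗[ℚ] V₂),
        (∀ x y, ψ₂.form.baseChange ℂ (Zc x) y + ψ₂.form.baseChange ℂ x (Zc y) = 0) →
          ∀ Y ∈ I, Zc * Y - Y * Zc ∈ I) → I ≠ ⊥ → Θ₂ ∈ I)
    {r : ℕ} (hdim : ∀ 𝔤₁ : Submodule ℚ (Module.End ℚ V₁),
      (∀ Y ∈ 𝔤₁, ∀ a : H₁.endAlg, Y * (a : Module.End ℚ V₁) = (a : Module.End ℚ V₁) * Y) →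
      (∀ Y ∈ 𝔤₁, ∀ v w, ψ₁.form (Y v) w + ψ₁.form v (Y w) = 0) → Module.finrank ℚ 𝔤₁ < r)
    (Z : Fin r → Module.End ℂ (ℂ ⊗[ℚ] V₂)) (hZind : LinearIndependent ℂ Z)
    (hZskew : ∀ i x y, ψ₂.form.baseChange ℂ (Z i x) y + ψ₂.form.baseChange ℂ x (Z i y) = 0)
    (eQ : Module.Basis (Fin M) ℚ U) (q : (Fin d → Fin m × Fin M) → ℚ)
    {ΘU : Module.End ℂ (ℂ ⊗[ℚ] U)} (hΘU : ∀ p, ∀ x ∈ HU.piece p (n - p), ΘU x = ((2 * p - n : ℤ) : ℂ) • x)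
    (hΘq : ∀ u : Fin d → Fin m, wordDerAt ℂ (fun _ : Fin d =>
      LinearMap.toMatrix (Algebra.TensorProduct.basis ℂ eQ) (Algebra.TensorProduct.basis ℂ eQ) ΘU)
      (wordSlice (fun w => algebraMap ℚ ℂ (q w)) u) = 0)
    {Y : Module.End ℂ (ℂ ⊗[ℚ] V₂)}
    (hY : ∀ x y, ψ₂.form.baseChange ℂ (Y x) y + ψ₂.form.baseChange ℂ x (Y y) = 0) (u : Fin d → Fin m) :
    wordDerAt ℂ (fun _ : Fin d =>
      LinearMap.toMatrix (Algebra.TensorProduct.basis ℂ eQ) (Algebra.TensorProduct.basis ℂ eQ)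
        (ι₂.baseChange ℂ ∘ₗ Y ∘ₗ π₂.baseChange ℂ))
      (wordSlice (fun w => algebraMap ℚ ℂ (q w)) u) = 0 := by
  classical
  set aF : H₁.endAlg ⊕ (Unit ⊕ Unit) → Module.End ℚ U :=
    Sum.elim (fun a : H₁.endAlg => ι₁ ∘ₗ (a : Module.End ℚ V₁) ∘ₗ π₁)
      (Sum.elim (fun _ : Unit => ι₁ ∘ₗ π₁) (fun _ : Unit => ι₂ ∘ₗ π₂)) with haF
  set φ : LinearMap.BilinForm ℚ U := ψ₁.form.compl₁₂ π₁ π₁ + ψ₂.form.compl₁₂ π₂ π₂ with hφ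
  set 𝔞 : Submodule ℚ (Module.End ℚ U) := annLie φ eQ aF q with h𝔞
  obtain ⟨-, h2, hΘ𝔞⟩ := incl_corner_mem_annLie_of_realBlocks_times_symplectic HU H₁ H₂ hπι₁ hπι₂ hπ₁ι₂ hπ₂ι₁
    hsum hι₁F hι₂F ψ₁ ψ₂ hΘ₂ hrigid hideal hdim Z hZind hZskew eQ q hΘU hΘq
  -- the rational Lie algebra of all `ψ₂`-skew operators and (RIGID) for it
  let 𝔰 : Submodule ℚ (Module.End ℚ V₂) :=
    { carrier := {X | ∀ v w, ψ₂.form (X v) w + ψ₂.form v (X w) = 0}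
      zero_mem' := fun v w => by simp
      add_mem' := by
        intro X X' hX hX' v w
        simp only [LinearMap.add_apply, map_add]
        have h1 := hX v w
        have h2 := hX' v w
        linear_combination h1 + h2
      smul_mem' := by
        intro c X hX v w
        simp only [LinearMap.smul_apply, map_smul, smul_eq_mul]
        have h1 := hX v w
        linear_combination c * h1 }
  have hmem𝔰 : ∀ X, X ∈ 𝔰 ↔ ∀ v w, ψ₂.form (X v) w + ψ₂.form v (X w) = 0 := fun X => Iff.rfl
  have h𝔰br : ∀ X ∈ 𝔰, ∀ X' ∈ 𝔰, X * X' - X' * X ∈ 𝔰 := by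
    intro X hX X' hX'
    rw [hmem𝔰] at hX hX' ⊢
    intro v w
    simp only [LinearMap.sub_apply, Module.End.mul_apply, map_sub, LinearMap.sub_apply]
    have h1 := hX (X' v) w
    have h2 := hX' v (X w)
    have h3 := hX' (X v) w
    have h4 := hX v (X' w)
    linear_combination h1 - h3 + h4 - h2
  have h𝔰skew : ∀ X ∈ 𝔰, ∀ v w, ψ₂.form (X v) w + ψ₂.form v (X w) = 0 := fun X hX => (hmem𝔰 X).1 hX
  -- `Θ₂ ∈ 𝔰_ℂ`: the second corners of `𝔞` are `ψ₂`-skew and `Θ₂ = c₂ Θ_U`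
  have hΘι₂ := theta_incl_eq HU H₂ hι₂F hΘU hΘ₂
  have e22 : ∀ w, π₂ (ι₂ w) = w := fun w => by
    rw [← LinearMap.comp_apply (f := π₂), hπι₂, LinearMap.id_apply]
  have e12 : ∀ w, π₁ (ι₂ w) = 0 := fun w => by
    rw [← LinearMap.comp_apply (f := π₁), hπ₁ι₂, LinearMap.zero_apply]
  have hmem : ∀ X ∈ 𝔞, (∀ i, X * aF i = aF i * X) ∧ ∀ v w, φ (X v) w + φ v (X w) = 0 :=
    fun X hX => ((mem_annLie_iff φ eQ aF q X).1 hX).2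
  have hP₂ : ∀ X ∈ 𝔞, X * (ι₂ ∘ₗ π₂) = (ι₂ ∘ₗ π₂) * X := fun X hX => (hmem X hX).1 (Sum.inr (Sum.inr ()))
  have hφapply : ∀ x y, φ x y = ψ₁.form (π₁ x) (π₁ y) + ψ₂.form (π₂ x) (π₂ y) := fun x y => by
    rw [hφ, LinearMap.add_apply, LinearMap.add_apply, LinearMap.compl₁₂_apply, LinearMap.compl₁₂_apply]
  have hc₂𝔰 : ∀ X ∈ 𝔞, π₂ ∘ₗ X ∘ₗ ι₂ ∈ 𝔰 := by
    intro X hX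
    rw [hmem𝔰]
    intro v w
    have h := (hmem X hX).2 (ι₂ v) (ι₂ w)
    rw [apply_incl_eq_of_commute_projector hπι₂ (hP₂ X hX) v,
      apply_incl_eq_of_commute_projector hπι₂ (hP₂ X hX) w, hφapply, hφapply] at h
    simp only [e22, e12, map_zero, zero_add] at h
    simpa only [LinearMap.comp_apply] using h
  have hcorner₂ : ∀ T ∈ spanC 𝔞, π₂.baseChange ℂ ∘ₗ T ∘ₗ ι₂.baseChange ℂ ∈ spanC 𝔰 := by
    intro T hT
    induction hT using Submodule.span_induction with
    | mem Z' hZ' =>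
      obtain ⟨X, hX, rfl⟩ := hZ'
      rw [← LinearMap.baseChange_comp, ← LinearMap.baseChange_comp]
      exact baseChange_mem_spanC (hc₂𝔰 X hX)
    | zero => rw [LinearMap.zero_comp, LinearMap.comp_zero]; exact Submodule.zero_mem _
    | add Z' Z'' _ _ hZ' hZ'' => rw [LinearMap.add_comp, LinearMap.comp_add]; exact Submodule.add_mem _ hZ' hZ''
    | smul c Z' _ hZ' => rw [LinearMap.smul_comp, LinearMap.comp_smul]; exact Submodule.smul_mem _ c hZ'
  have hΘ𝔰 : Θ₂ ∈ spanC 𝔰 := by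
    have h : Θ₂ = π₂.baseChange ℂ ∘ₗ ΘU ∘ₗ ι₂.baseChange ℂ := by
      apply LinearMap.ext
      intro x
      rw [LinearMap.comp_apply, LinearMap.comp_apply, hΘι₂, proj_incl_baseChange hπι₂]
    rw [h]
    exact hcorner₂ ΘU hΘ𝔞
  have hY𝔰 : Y ∈ spanC 𝔰 := hrigid 𝔰 h𝔰br h𝔰skew hΘ𝔰 Y hY
  -- elements of `𝔰_ℂ`, placed on `V₂`, lie in `𝔞_ℂ`
  have hplace : ∀ Y' ∈ spanC 𝔰, ι₂.baseChange ℂ ∘ₗ Y' ∘ₗ π₂.baseChange ℂ ∈ spanC 𝔞 := by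
    intro Y' hY'
    induction hY' using Submodule.span_induction with
    | mem Y₁ hY₁ =>
      obtain ⟨X, hX, rfl⟩ := hY₁
      rw [← LinearMap.baseChange_comp, ← LinearMap.baseChange_comp]
      exact baseChange_mem_spanC (h2 X ((hmem𝔰 X).1 hX))
    | zero => rw [LinearMap.zero_comp, LinearMap.comp_zero]; exact Submodule.zero_mem _
    | add Y₁ Y₂ _ _ hY₁ hY₂ => rw [LinearMap.add_comp, LinearMap.comp_add]; exact Submodule.add_mem _ hY₁ hY₂
    | smul c Y₁ _ hY₁ => rw [LinearMap.smul_comp, LinearMap.comp_smul]; exact Submodule.smul_mem _ c hY₁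
  exact wordDerAt_eq_zero_of_mem_spanC_annLie φ eQ aF q (hplace _ hY𝔰) u

end Main

end HodgeStructure

end Literature.AlgebraicGeometry.Motives

end
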